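import Mathlib
import HarnessLib
import Literature.Analysis.FluidPDE.TypeIAncientMild
import Literature.Analysis.FluidPDE.NSLerayOseenRepresentation
import Literature.Analysis.FluidPDE.LerayVolterraComparison
import Summits.NavierStokesRegularity.NavierStokesRegularity.Theorems.QuarterLogPincerThinCascadeDefs

/-!
# Route `QuarterLogPincer`, crux `TypeIQuantSubcubicExp` (stmt-NavierStokesRegularity-24077), line `truncation_edge` — stub T4
# `stub_rateFloor` DISCHARGED (unfolded form): Leray's rate floor at the singular apex, in the KNSS (Oseen-mild) gauge

Line `Cruxes/TypeIQuantSubcubicExp/Lines/truncation_edge.lean` (ns-idea-7 g8, v1.1; idea-crit-4 PASS; DIRECTOR-NS dss_105 (2)) registers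
`StubRateFloor : ∀ M v, IsTypeIAncientMild M v → SingularAt v 0 → RateFloor v`, with the line object
`RateFloor v := ∃ c > 0, ∀ s ∈ [−1, 0), ∃ x, c/√(−s) ≤ ‖v s x‖` and `SingularAt` the landed `…ThinCascadeDefs` predicate
(unbounded on every backward parabolic neighbourhood of `(0, 0)`).  As for T3, the conclusion is proved UNFOLDED
(`rateFloor_of_singularAt`); `stub_rateFloor := fun M v hv hs => rateFloor_of_singularAt M v hv hs` once the line's Defs module lands.

PROOF — Leray 1934 §21 (3.14)–(3.16) transplanted to the Oseen gauge, where the mild identity is a HYPOTHESIS of the class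
(`IsTypeIAncientMild`: `v(t) = e^{(t−s)Δ}v(s) − B¹_s(v,v)(t)` between all `s < t < 0`), so that no existence, uniqueness or
Leray–Hopf structure is needed:
* `exists_norm_le_const_add_volterra_of_oseenMild` — Leray's integral inequality (3.5) for an Oseen-mild field from time `0`:
  maximum principle for `e^{tΔ}` (`UnboundedOperators.norm_heatExtension_le`) + the weighted Duhamel bound
  (`exists_enorm_oseenDuhamel_weighted_le`, Ożański–Pooley Lemma 6.9 (i));
* `exists_norm_le_two_mul_of_window_of_oseenMild` — Leray's (3.15) with the constant supersolution `2V₀` on the window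
  `64C₁²V₀²t < 1` (the tree's comparison principle `volterra_sqrt_comparison`, Ożański–Pooley Lemma 6.5; the measurable majorant is
  the lower-semicontinuous clamped sup norm, verbatim the device of the landed `exists_norm_le_two_mul_of_window`);
* `rateFloor_of_singularAt` — with `c = (16C₁)⁻¹`: if `sup_x ‖v(s₀,x)‖ < c/√(−s₀)` the window covers `[s₀, 0)`, so `v` is bounded
  by `2c/√(−s₀)` on `(s₀,0) × ℝ³` (time-translate by `s₀`, `oseenDuhamel_comp_sub_right`), contradicting `SingularAt v 0` on the
  parabolic neighbourhood of radius `√(−s₀)`.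

HONEST FRAMING: an elementary a-priori estimate for HYPOTHETICAL Type-I ancient mild objects (an edge/calibration piece of the line);
crux 24077, item 22144 and Navier–Stokes regularity are OPEN and untouched.
[cite: Leray1934, §21 (3.14)–(3.16) p. 226; §19 (3.9)] [cite: OzanskiPooley2018, Lemma 6.23 (i), Lemma 6.5]
[cite: KochNadirashviliSereginSverak2009, §4 p. 8 (arXiv:0709.3599)]
-/

noncomputable section

set_option linter.dupNamespace false

namespace Summit.NavierStokesRegularity.NavierStokesRegularity.Theorems.QuarterLogPincerTruncationEdge

open MeasureTheory Set Function Filter Real Metric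
open scoped ENNReal NNReal Topology
open Literature.Analysis Literature.Analysis.FluidPDE
open Summit.NavierStokesRegularity.NavierStokesRegularity.Cruxes.TypeIQuantSubcubicExp.ThinCascade (SingularAt)

/-! ## Leray's integral inequality for an Oseen-mild field (unit viscosity, base time `0`) -/

/-- **Leray's (3.5) in the Oseen gauge.** There is a universal `C₁ > 0` such that: if `w t = e^{tΔ}w(0) − B¹₀(w,w)(t)` pointwise for
`t ∈ (0, T₁]`, `V` is a measurable majorant of the slices on `[0, T₁]` (`‖w τ y‖ ≤ V τ ≤ M`, `0 ≤ V`) and `‖w 0 y‖ ≤ V₀`, then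
`‖w(t,x)‖ ≤ V₀ + C₁ ∫_{(0,t)} (t−τ)^{−1/2} V(τ)² dτ` for `t ∈ (0, T₁]`.
[cite: Leray1934, §17 (3.5) p. 221] [cite: OzanskiPooley2018, (6.65) with Lemma 6.9 (i)] -/
theorem exists_norm_le_const_add_volterra_of_oseenMild :
    ∃ C₁ : ℝ, 0 < C₁ ∧ ∀ {T₁ M V₀ : ℝ}
      {w : ℝ → EuclideanSpace ℝ (Fin 3) → EuclideanSpace ℝ (Fin 3)} {V : ℝ → ℝ},
      (∀ t ∈ Ioc 0 T₁, ∀ x, w t x = heatFlow (w 0) t x - oseenDuhamel 1 0 w w t x) →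
      Measurable V → (∀ τ, 0 ≤ V τ) → (∀ τ, V τ ≤ M) →
      (∀ τ ∈ Icc 0 T₁, ∀ y, ‖w τ y‖ ≤ V τ) →
      (∀ y, ‖w 0 y‖ ≤ V₀) →
      ∀ t ∈ Ioc 0 T₁, ∀ x,
        ‖w t x‖ ≤ V₀ + C₁ * ∫ τ in Ioo 0 t, (t - τ) ^ (-(1 / 2 : ℝ)) * V τ ^ 2 := by
  obtain ⟨C₁, hC₁, hDuh⟩ := exists_enorm_oseenDuhamel_weighted_le (E := EuclideanSpace ℝ (Fin 3))
  refine ⟨C₁, hC₁, ?_⟩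
  intro T₁ M V₀ w V hmild hVm hV0 hVM hVu hV₀ t ht x
  have ht0 : 0 < t := ht.1
  -- ### the heat term: maximum principle
  have hheat : ‖heatFlow (w 0) t x‖ ≤ V₀ := by
    rw [heatFlow_of_pos _ ht0]
    exact UnboundedOperators.norm_heatExtension_le hV₀ ht0 x
  -- ### the Duhamel term
  have hI0 : 0 ≤ ∫ τ in Ioo 0 t, (t - τ) ^ (-(1 / 2 : ℝ)) * V τ ^ 2 :=
    setIntegral_nonneg measurableSet_Ioo fun τ hτ =>
      mul_nonneg (Real.rpow_nonneg (sub_nonneg.2 hτ.2.le) _) (sq_nonneg _)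
  have hB : ‖oseenDuhamel 1 0 w w t x‖ ≤ C₁ * ∫ τ in Ioo 0 t, (t - τ) ^ (-(1 / 2 : ℝ)) * V τ ^ 2 := by
    have hVu' : ∀ τ ∈ Ioo 0 t, ∀ z, ‖w τ z‖ ≤ V τ := fun τ hτ z =>
      hVu τ ⟨hτ.1.le, hτ.2.le.trans ht.2⟩ z
    have h1 := hDuh one_pos (u := w) (v := w) (s := 0) (t := t) (V := V) (fun τ _ => hV0 τ) hVu' hVu' x
    have hEq : EqOn (fun τ => C₁ * V τ ^ 2 * (1 * (t - τ)) ^ (-(1 / 2 : ℝ)))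
        (fun τ => C₁ * ((t - τ) ^ (-(1 / 2 : ℝ)) * V τ ^ 2)) (Ioo 0 t) := by
      intro τ _
      show C₁ * V τ ^ 2 * (1 * (t - τ)) ^ (-(1 / 2 : ℝ)) = C₁ * ((t - τ) ^ (-(1 / 2 : ℝ)) * V τ ^ 2)
      rw [one_mul]
      ring
    have hkern : IntegrableOn (fun τ => (t - τ) ^ (-(1 / 2 : ℝ)) * V τ ^ 2) (Ioo 0 t) := by
      refine Integrable.mul_bdd (c := M ^ 2) (integrableOn_sub_rpow_Ioo (by norm_num))
        ((hVm.pow_const 2).aestronglyMeasurable) (Eventually.of_forall fun τ => ?_)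
      rw [Real.norm_of_nonneg (sq_nonneg _)]
      exact pow_le_pow_left₀ (hV0 τ) (hVM τ) 2
    have hint : IntegrableOn (fun τ => C₁ * V τ ^ 2 * (1 * (t - τ)) ^ (-(1 / 2 : ℝ))) (Ioo 0 t) :=
      IntegrableOn.congr_fun (hkern.const_mul C₁) hEq.symm measurableSet_Ioo
    have hnn : 0 ≤ᵐ[volume.restrict (Ioo 0 t)] fun τ => C₁ * V τ ^ 2 * (1 * (t - τ)) ^ (-(1 / 2 : ℝ)) := by
      refine (ae_restrict_iff' measurableSet_Ioo).2 (Eventually.of_forall fun τ hτ => ?_)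
      show (0 : ℝ) ≤ C₁ * V τ ^ 2 * (1 * (t - τ)) ^ (-(1 / 2 : ℝ))
      exact mul_nonneg (mul_nonneg hC₁.le (sq_nonneg _))
        (Real.rpow_nonneg (by rw [one_mul]; exact sub_nonneg.2 hτ.2.le) _)
    rw [← ofReal_integral_eq_lintegral_ofReal hint hnn, setIntegral_congr_fun measurableSet_Ioo hEq,
      integral_const_mul, ← ofReal_norm, ENNReal.ofReal_le_ofReal_iff (mul_nonneg hC₁.le hI0)] at h1
    exact h1
  rw [hmild t ht x]
  exact (norm_sub_le _ _).trans (add_le_add hheat hB)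

/-! ## Leray's (3.15): the a-priori doubling bound on the window -/

/-- **Leray's a-priori sup bound in the Oseen gauge.** With the constant `C₁` of `exists_norm_le_const_add_volterra_of_oseenMild`:
if `w` is jointly continuous on `[0, T₁] × ℝ³`, Oseen-mild from time `0` on `(0, T₁]`, bounded by `M` there, and `‖w(0, ·)‖ ≤ V₀`
(`0 < V₀`), then `‖w(t, x)‖ ≤ 2V₀` for every `t ∈ (0, T₁]` in the window `64 C₁² V₀² t < 1` (constant supersolution `2V₀` and
the comparison principle `volterra_sqrt_comparison` for the lower-semicontinuous clamped sup norm).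
[cite: Leray1934, §21 (3.14)–(3.15) p. 226] [cite: OzanskiPooley2018, Lemma 6.23 (i) with Lemma 6.5] -/
theorem exists_norm_le_two_mul_of_window_of_oseenMild :
    ∃ C₁ : ℝ, 0 < C₁ ∧ ∀ {T₁ M V₀ : ℝ}
      {w : ℝ → EuclideanSpace ℝ (Fin 3) → EuclideanSpace ℝ (Fin 3)},
      0 < T₁ → ContinuousOn (uncurry w) (Icc 0 T₁ ×ˢ univ) →
      (∀ t ∈ Ioc 0 T₁, ∀ x, w t x = heatFlow (w 0) t x - oseenDuhamel 1 0 w w t x) →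
      0 < M → (∀ s ∈ Icc 0 T₁, ∀ y, ‖w s y‖ ≤ M) →
      0 < V₀ → (∀ y, ‖w 0 y‖ ≤ V₀) →
      ∀ t ∈ Ioc 0 T₁, 64 * C₁ ^ 2 * V₀ ^ 2 * t < 1 → ∀ x, ‖w t x‖ ≤ 2 * V₀ := by
  obtain ⟨C₁, hC₁, hA⟩ := exists_norm_le_const_add_volterra_of_oseenMild
  refine ⟨C₁, hC₁, ?_⟩
  intro T₁ M V₀ w hT₁ hcont₁ hmild hMpos hMb hV₀ hu₀ t ht htw x
  -- ### the clamped field and its sup norm `V`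
  obtain ⟨cl, hcl_def⟩ : ∃ cl : ℝ → ℝ, cl = fun τ => max 0 (min τ T₁) := ⟨_, rfl⟩
  have hcl_mem : ∀ τ, cl τ ∈ Icc 0 T₁ := fun τ => by
    rw [hcl_def]
    exact ⟨le_max_left _ _, max_le hT₁.le (min_le_right _ _)⟩
  have hcl_id : ∀ τ ∈ Icc 0 T₁, cl τ = τ := fun τ hτ => by
    rw [hcl_def]
    show max 0 (min τ T₁) = τ
    rw [min_eq_left hτ.2, max_eq_right hτ.1]
  have hcl_cont : Continuous cl := by
    rw [hcl_def]
    exact continuous_const.max (continuous_id.min continuous_const)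
  obtain ⟨V, hV⟩ : ∃ V : ℝ → ℝ, V = fun τ => ⨆ y, ‖w (cl τ) y‖ := ⟨_, rfl⟩
  have hbddV : ∀ τ, BddAbove (range fun y => ‖w (cl τ) y‖) := fun τ =>
    ⟨M, forall_mem_range.2 fun y => hMb _ (hcl_mem τ) y⟩
  have hVle : ∀ τ y, ‖w (cl τ) y‖ ≤ V τ := fun τ y => by
    rw [hV]
    exact le_ciSup (hbddV τ) y
  have hV0 : ∀ τ, 0 ≤ V τ := fun τ => (norm_nonneg _).trans (hVle τ 0)
  have hVM : ∀ τ, V τ ≤ M := fun τ => by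
    rw [hV]
    exact ciSup_le fun y => hMb _ (hcl_mem τ) y
  have hVu : ∀ τ ∈ Icc 0 T₁, ∀ y, ‖w τ y‖ ≤ V τ := fun τ hτ y => by
    have h := hVle τ y
    rwa [hcl_id τ hτ] at h
  have hVm : Measurable V := by
    have hcy : ∀ y : EuclideanSpace ℝ (Fin 3), Continuous fun τ : ℝ => ‖w (cl τ) y‖ := fun y => by
      have h1 : Continuous fun τ : ℝ => (cl τ, y) := hcl_cont.prodMk continuous_const
      exact (hcont₁.comp_continuous h1 fun τ => ⟨hcl_mem τ, mem_univ _⟩).norm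
    rw [hV]
    exact (lowerSemicontinuous_ciSup
      (f := fun (y : EuclideanSpace ℝ (Fin 3)) (τ : ℝ) => ‖w (cl τ) y‖) hbddV
      fun y => (hcy y).lowerSemicontinuous).measurable
  -- ### Leray's integral inequality for `V` on `(0, T₁]`
  have hVolt : ∀ s ∈ Ioc 0 T₁, V s ≤ V₀ + C₁ * ∫ τ in Ioo 0 s, (s - τ) ^ (-(1 / 2 : ℝ)) * V τ ^ 2 := by
    intro s hs
    have hsup := hA hmild hVm hV0 hVM hVu hu₀ s hs
    have hVs : V s = ⨆ y, ‖w s y‖ := by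
      rw [hV]
      show (⨆ y, ‖w (cl s) y‖) = ⨆ y, ‖w s y‖
      rw [hcl_id s ⟨hs.1.le, hs.2⟩]
    rw [hVs]
    exact ciSup_le hsup
  -- integrability of the memory integrand and the crude bound `∫ ≤ M² · 2√s`
  have hkV : ∀ s : ℝ, IntegrableOn (fun τ => (s - τ) ^ (-(1 / 2 : ℝ)) * V τ ^ 2) (Ioo 0 s) := by
    intro s
    refine Integrable.mul_bdd (c := M ^ 2) (integrableOn_sub_rpow_Ioo (by norm_num))
      ((hVm.pow_const 2).aestronglyMeasurable) (Eventually.of_forall fun τ => ?_)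
    rw [Real.norm_of_nonneg (sq_nonneg _)]
    exact pow_le_pow_left₀ (hV0 τ) (hVM τ) 2
  have hcrude : ∀ s : ℝ, 0 < s →
      ∫ τ in Ioo 0 s, (s - τ) ^ (-(1 / 2 : ℝ)) * V τ ^ 2 ≤ M ^ 2 * (2 * Real.sqrt s) := by
    intro s hs
    have hk : IntegrableOn (fun τ : ℝ => (s - τ) ^ (-(1 / 2 : ℝ))) (Ioo 0 s) :=
      integrableOn_sub_rpow_Ioo (by norm_num)
    calc ∫ τ in Ioo 0 s, (s - τ) ^ (-(1 / 2 : ℝ)) * V τ ^ 2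
        ≤ ∫ τ in Ioo 0 s, (s - τ) ^ (-(1 / 2 : ℝ)) * M ^ 2 := by
          refine setIntegral_mono_on (hkV s) (hk.mul_const _) measurableSet_Ioo fun τ hτ => ?_
          exact mul_le_mul_of_nonneg_left (pow_le_pow_left₀ (hV0 τ) (hVM τ) 2)
            (Real.rpow_nonneg (sub_nonneg.2 hτ.2.le) _)
      _ = M ^ 2 * (2 * Real.sqrt s) := by
          rw [integral_mul_const, setIntegral_Ioo_sub_rpow_neg_half hs.le, sub_zero,
            ← Real.sqrt_eq_rpow, mul_comm]
  -- ### the initial segment: `V ≤ 2V₀` on `(0, δ]`, from the inequality itself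
  set δ₀ : ℝ := (V₀ / (2 * C₁ * M ^ 2 + 1)) ^ 2 with hδ₀
  have hden : 0 < 2 * C₁ * M ^ 2 + 1 := by positivity
  have hδ₀pos : 0 < δ₀ := by positivity
  set δ : ℝ := min T₁ δ₀ with hδ
  have hδpos : 0 < δ := lt_min hT₁ hδ₀pos
  have hinit : ∀ τ ∈ Ioc 0 δ, V τ ≤ 2 * V₀ := by
    intro τ hτ
    have hτT₁ : τ ≤ T₁ := hτ.2.trans (min_le_left _ _)
    have hτδ₀ : τ ≤ δ₀ := hτ.2.trans (min_le_right _ _)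
    have hsq : Real.sqrt τ ≤ V₀ / (2 * C₁ * M ^ 2 + 1) := by
      calc Real.sqrt τ ≤ Real.sqrt δ₀ := Real.sqrt_le_sqrt hτδ₀
        _ = V₀ / (2 * C₁ * M ^ 2 + 1) := Real.sqrt_sq (by positivity)
    have h1 : C₁ * (M ^ 2 * (2 * Real.sqrt τ)) ≤ V₀ := by
      calc C₁ * (M ^ 2 * (2 * Real.sqrt τ)) = 2 * C₁ * M ^ 2 * Real.sqrt τ := by ring
        _ ≤ 2 * C₁ * M ^ 2 * (V₀ / (2 * C₁ * M ^ 2 + 1)) :=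
            mul_le_mul_of_nonneg_left hsq (by positivity)
        _ ≤ (2 * C₁ * M ^ 2 + 1) * (V₀ / (2 * C₁ * M ^ 2 + 1)) :=
            mul_le_mul_of_nonneg_right (by linarith) (by positivity)
        _ = V₀ := by field_simp
    calc V τ ≤ V₀ + C₁ * ∫ σ in Ioo 0 τ, (τ - σ) ^ (-(1 / 2 : ℝ)) * V σ ^ 2 :=
          hVolt τ ⟨hτ.1, hτT₁⟩
      _ ≤ V₀ + C₁ * (M ^ 2 * (2 * Real.sqrt τ)) := by
          gcongr
          exact hcrude τ hτ.1
      _ ≤ V₀ + V₀ := by linarith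
      _ = 2 * V₀ := by ring
  -- ### the strict supersolution `ψ ≡ 2V₀` on the window `(0, t]`
  have hψint : ∀ τ : ℝ, 0 < τ →
      ∫ σ in Ioo 0 τ, (τ - σ) ^ (-(1 / 2 : ℝ)) * (2 * V₀) ^ 2 = (2 * V₀) ^ 2 * (2 * Real.sqrt τ) := by
    intro τ hτ
    rw [integral_mul_const, setIntegral_Ioo_sub_rpow_neg_half hτ.le, sub_zero, ← Real.sqrt_eq_rpow, mul_comm]
  have hψG : ∀ τ ∈ Ioc 0 t, V₀ + C₁ * ∫ σ in Ioo 0 τ, (τ - σ) ^ (-(1 / 2 : ℝ)) * (2 * V₀) ^ 2 ≤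
      V₀ + C₁ * ((2 * V₀) ^ 2 * (2 * Real.sqrt τ)) := fun τ hτ => by rw [hψint τ hτ.1]
  have hGψ : ∀ τ ∈ Ioc 0 t, V₀ + C₁ * ((2 * V₀) ^ 2 * (2 * Real.sqrt τ)) < 2 * V₀ := by
    intro τ hτ
    have h64 : 64 * C₁ ^ 2 * V₀ ^ 2 * τ < 1 := by
      have : 64 * C₁ ^ 2 * V₀ ^ 2 * τ ≤ 64 * C₁ ^ 2 * V₀ ^ 2 * t :=
        mul_le_mul_of_nonneg_left hτ.2 (by positivity)
      exact this.trans_lt htw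
    have hsq : (8 * C₁ * V₀ * Real.sqrt τ) ^ 2 = 64 * C₁ ^ 2 * V₀ ^ 2 * τ := by
      rw [mul_pow, Real.sq_sqrt hτ.1.le]
      ring
    have h1 : 8 * C₁ * V₀ * Real.sqrt τ < 1 := by
      have h2 : (8 * C₁ * V₀ * Real.sqrt τ) ^ 2 < 1 ^ 2 := by rw [hsq, one_pow]; exact h64
      exact (pow_lt_pow_iff_left₀ (by positivity) zero_le_one two_ne_zero).1 h2
    have hid : C₁ * ((2 * V₀) ^ 2 * (2 * Real.sqrt τ)) = V₀ * (8 * C₁ * V₀ * Real.sqrt τ) := by ring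
    rw [hid]
    have h3 := mul_lt_mul_of_pos_left h1 hV₀
    linarith
  have hGc : ContinuousOn (fun τ => V₀ + C₁ * ((2 * V₀) ^ 2 * (2 * Real.sqrt τ))) (Ioc 0 t) :=
    continuousOn_const.add (continuousOn_const.mul (continuousOn_const.mul
      (continuousOn_const.mul Real.continuous_sqrt.continuousOn)))
  have hψc : ContinuousOn (fun _ : ℝ => 2 * V₀) (Ioc 0 t) := continuousOn_const
  have hψi : ∀ τ ∈ Ioc 0 t,
      IntegrableOn (fun σ => (τ - σ) ^ (-(1 / 2 : ℝ)) * (2 * V₀) ^ 2) (Ioo 0 τ) := fun τ _ =>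
    (integrableOn_sub_rpow_Ioo (by norm_num)).mul_const _
  have hV' : ∀ τ ∈ Ioc 0 t,
      V τ ≤ V₀ + C₁ * ∫ σ in Ioo 0 τ, (τ - σ) ^ (-(1 / 2 : ℝ)) * V σ ^ 2 := fun τ hτ =>
    hVolt τ ⟨hτ.1, hτ.2.trans ht.2⟩
  -- ### the comparison principle
  have hcomp := volterra_sqrt_comparison (V := V) (ψ := fun _ => 2 * V₀)
    (G := fun τ => V₀ + C₁ * ((2 * V₀) ^ 2 * (2 * Real.sqrt τ))) (a := fun _ => V₀) (C := C₁)
    (M := M) (t₁ := t) (δ := δ) hC₁.le hδpos hVm (fun τ _ => hV0 τ) (fun τ _ => hVM τ) hV' hψG hGψ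
    hGc hψc hψi hinit
  exact (hVu t ⟨ht.1.le, ht.2⟩ x).trans (hcomp t ⟨ht.1, le_rfl⟩)

/-! ## T4, unfolded: the rate floor at the singular apex -/

/-- **Stub T4 `stub_rateFloor` of line `truncation_edge` (crux 24077), conclusion unfolded verbatim**: a Type-I ancient mild
field in the KNSS gauge (`IsTypeIAncientMild M v`) which is singular at the origin at time `0` (`SingularAt v 0`: unbounded on every
backward parabolic neighbourhood `B_r(0) × (−r², 0)`) obeys Leray's floor `∃ c > 0, ∀ s ∈ [−1, 0), ∃ x, c/√(−s) ≤ ‖v s x‖`, with the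
universal `c = (16 C₁)⁻¹`.  (If `sup ‖v(s₀)‖ < c/√(−s₀)`, the doubling window `64C₁²(c²/(−s₀))t < 1` covers `t ≤ −s₀`, so `v` is
bounded by `2c/√(−s₀)` on `(s₀, 0) × ℝ³`, against `SingularAt v 0` at radius `√(−s₀)`.)
[cite: Leray1934, §19 (3.9) p. 224; §21 (3.16) p. 226] [cite: KochNadirashviliSereginSverak2009, §4 p. 8] -/
theorem rateFloor_of_singularAt (M : ℝ) (v : ℝ → EuclideanSpace ℝ (Fin 3) → EuclideanSpace ℝ (Fin 3))
    (hv : IsTypeIAncientMild M v) (hsing : SingularAt v 0) :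
    ∃ c : ℝ, 0 < c ∧ ∀ s ∈ Set.Ico (-1 : ℝ) 0, ∃ x : EuclideanSpace ℝ (Fin 3),
      c / Real.sqrt (-s) ≤ ‖v s x‖ := by
  obtain ⟨C₁, hC₁, hwin⟩ := exists_norm_le_two_mul_of_window_of_oseenMild
  refine ⟨(16 * C₁)⁻¹, by positivity, fun s₀ hs₀ => ?_⟩
  by_contra hno
  push Not at hno
  obtain ⟨hsm, -, hmild, hrate⟩ := hv
  have hs₀0 : 0 < -s₀ := by linarith [hs₀.2]
  set V₀ : ℝ := (16 * C₁)⁻¹ / Real.sqrt (-s₀) with hV₀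
  have hV₀pos : 0 < V₀ := by positivity
  have hu₀ : ∀ y, ‖v s₀ y‖ ≤ V₀ := fun y => (hno y).le
  -- the window covers `[s₀, 0)`: `64 C₁² V₀² (−s₀) = 1/4`
  have hs₀ne : s₀ ≠ 0 := hs₀.2.ne
  have hV₀sq : V₀ ^ 2 * (-s₀) = ((16 * C₁)⁻¹) ^ 2 := by
    rw [hV₀, div_pow, Real.sq_sqrt hs₀0.le]
    field_simp
  have hwin₀ : 64 * C₁ ^ 2 * V₀ ^ 2 * (-s₀) < 1 := by
    have h2 : 64 * C₁ ^ 2 * V₀ ^ 2 * (-s₀) = 1 / 4 := by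
      rw [mul_assoc (64 * C₁ ^ 2), hV₀sq]
      field_simp
      ring
    rw [h2]
    norm_num
  -- ### the a-priori bound `‖v t y‖ ≤ 2V₀` on `(s₀, 0) × ℝ³`
  have hbound : ∀ t ∈ Ioo s₀ 0, ∀ y, ‖v t y‖ ≤ 2 * V₀ := by
    intro t ht y
    set T₁ : ℝ := t - s₀ with hT₁
    have hT₁pos : 0 < T₁ := by rw [hT₁]; linarith [ht.1]
    -- the translate `w τ := v (τ + s₀)` on `[0, T₁]`
    set w : ℝ → EuclideanSpace ℝ (Fin 3) → EuclideanSpace ℝ (Fin 3) := fun τ => v (τ + s₀) with hw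
    have hw0 : w 0 = v s₀ := by
      show v (0 + s₀) = v s₀
      rw [zero_add]
    -- joint continuity on the closed strip (the strip `[s₀, t] × ℝ³` lies in the open past)
    have hcontw : ContinuousOn (uncurry w) (Icc 0 T₁ ×ˢ univ) := by
      have hsh : Continuous fun q : ℝ × EuclideanSpace ℝ (Fin 3) => (q.1 + s₀, q.2) :=
        (continuous_fst.add continuous_const).prodMk continuous_snd
      have hmaps : MapsTo (fun q : ℝ × EuclideanSpace ℝ (Fin 3) => (q.1 + s₀, q.2)) (Icc 0 T₁ ×ˢ univ)
          (Iio 0 ×ˢ univ) := fun q hq => ⟨by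
            show q.1 + s₀ < 0
            have := (mem_prod.1 hq).1.2
            rw [hT₁] at this
            linarith [ht.2], mem_univ _⟩
      have h := hsm.continuousOn.comp hsh.continuousOn hmaps
      refine h.congr fun q _ => ?_
      rfl
    -- the mild identity from time `0` for `w`
    have hmildw : ∀ τ ∈ Ioc 0 T₁, ∀ x, w τ x = heatFlow (w 0) τ x - oseenDuhamel 1 0 w w τ x := by
      intro τ hτ x
      have hτs : s₀ < τ + s₀ := by linarith [hτ.1]
      have hτ0 : τ + s₀ < 0 := by
        have := hτ.2
        rw [hT₁] at this
        linarith [ht.2]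
      have h1 := hmild s₀ (τ + s₀) hτs hτ0 x
      rw [add_sub_cancel_right] at h1
      have h2 : oseenDuhamel 1 0 w w τ x = oseenDuhamel 1 s₀ v v (τ + s₀) x := by
        have h3 := oseenDuhamel_comp_sub_right 1 0 τ (-s₀) v v x
        simp only [sub_neg_eq_add, zero_add] at h3
        exact h3
      rw [hw0, h2]
      exact h1
    -- the a-priori bound on the strip from the Type-I rate at its top
    set M₁ : ℝ := max (M / Real.sqrt (-t)) 1 with hM₁
    have hM₁pos : 0 < M₁ := lt_max_of_lt_right one_pos
    have hMb : ∀ τ ∈ Icc 0 T₁, ∀ y, ‖w τ y‖ ≤ M₁ := by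
      intro τ hτ y
      have hτ0 : τ + s₀ < 0 := by
        have := hτ.2
        rw [hT₁] at this
        linarith [ht.2]
      have hMnn : 0 ≤ M := by
        have h := hrate (τ + s₀) hτ0 y
        have hsq : 0 < Real.sqrt (-(τ + s₀)) := Real.sqrt_pos.2 (by linarith)
        by_contra hM
        push Not at hM
        have : M / Real.sqrt (-(τ + s₀)) < 0 := div_neg_of_neg_of_pos hM hsq
        linarith [norm_nonneg (v (τ + s₀) y)]
      refine le_trans ?_ (le_max_left _ _)
      calc ‖w τ y‖ = ‖v (τ + s₀) y‖ := rfl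
        _ ≤ M / Real.sqrt (-(τ + s₀)) := hrate (τ + s₀) hτ0 y
        _ ≤ M / Real.sqrt (-t) := by
            refine div_le_div_of_nonneg_left hMnn (Real.sqrt_pos.2 (by linarith [ht.2])) ?_
            exact Real.sqrt_le_sqrt (by have := hτ.2; rw [hT₁] at this; linarith)
    have hu₀w : ∀ y, ‖w 0 y‖ ≤ V₀ := by
      rw [hw0]
      exact hu₀
    have hwinT : 64 * C₁ ^ 2 * V₀ ^ 2 * T₁ < 1 := by
      have : 64 * C₁ ^ 2 * V₀ ^ 2 * T₁ ≤ 64 * C₁ ^ 2 * V₀ ^ 2 * (-s₀) :=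
        mul_le_mul_of_nonneg_left (by rw [hT₁]; linarith [ht.2]) (by positivity)
      exact this.trans_lt hwin₀
    have h := hwin hT₁pos hcontw hmildw hM₁pos hMb hV₀pos hu₀w T₁ ⟨hT₁pos, le_rfl⟩ hwinT y
    have hwT : w T₁ y = v t y := by
      show v (T₁ + s₀) y = v t y
      rw [hT₁, sub_add_cancel]
    rw [hwT] at h
    exact h
  -- ### contradiction with the singularity at the apex, radius `√(−s₀)`
  obtain ⟨t, ht, y, -, hlt⟩ := hsing (Real.sqrt (-s₀)) (Real.sqrt_pos.2 hs₀0) (2 * V₀)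
  rw [Real.sq_sqrt hs₀0.le, neg_neg] at ht
  exact absurd (hbound t ht y) (not_le.2 hlt)

end Summit.NavierStokesRegularity.NavierStokesRegularity.Theorems.QuarterLogPincerTruncationEdge

end
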